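import Literature.Computability.AlgebraicComplexity.TableauEvalLabelWalk
import HarnessLib

/-!
# Label-major evaluation of tableau highest-weight vectors (kernel-efficient dynamic programme)

Topic `Computability/AlgebraicComplexity`; an EXECUTABLE definitions file (kernel-evaluable by
`decide +kernel`, structural recursion only) for the Lean certificate checker of the GCT
multiplicity-obstruction engine (cell `pub-gct`; honest framing of that cell: rung-1
multiplicity-obstruction search for permanent versus determinant at small `(n, m)`; no claim about
VP ≠ VNP or P ≠ NP is made here or there).

`TableauEval.evalC` (`PlethysmTableauEvaluation.lean`) evaluates a tableau network column by column
— `∏_c h_c!` signed tuples of column bijections, out of reach of the kernel for the certificates of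
record of the cell (`(n, m) = (3, 3)`, `d = 10`, shape `(9,9,2,2,2,2,2,2)`: `8!·8!·2⁷` tuples).
This file computes the SAME number label by label — the transfer-matrix ("dynamic programming")
organisation of the proper-placement sum of [DorflerIkenmeyerPanova2020, §5, after "we observe
that"], there run over columns, here over labels, which is what keeps the state space small for
shapes dominated by two long columns. For a COLUMN-STRICT filling (labels strictly increasing down
every column, as in every semistandard tableau) the boxes labelled `u` are the topmost unassigned
boxes of the columns containing `u`; so processing the labels `0, 1, …, d-1` in turn and giving each
such box one of the still unused alternator variables of its column — the `j`-th unused one with the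
sign `(-1)^j`, i.e. the row expansion of the column's alternator — enumerates every tuple of column
bijections exactly once with its sign, while all that must be remembered between two labels is the
list of still unused variables of every column (the STATE). States reached along different routes
are merged and words whose symmetric-tensor entry vanishes are dropped as early as a prefix of the
word decides it; both are invisible to the value (`evalA_eq_evalC`, proofs files).

Contents (the specification level — residual columns, the walk `walkL` of one label, `specL`,
column-strictness — is `TableauEvalLabelWalk.lean`). §1 the pruned trie of the symmetric-tensor
entries `symEntry P w` of all words (the only place `symEntry` is evaluated); §2 the programme:
`walkA` (walk of one label over a state, descending the trie), `msortK` (merge sort by a packed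
key, depth fuel), `compressA` (adding up equal adjacent states), `expandA`/`stepA`, `layersA`,
**`evalA`**;
§3 kernel sanity values (`evalA = evalC = specL` on the toy network, `evalA = evalC` on a `3 × 3`
case). Correctness `evalA = evalC` for column-strict networks passing the structural check:
`TableauEvalLabelMajorImpl.lean`. Elementary [folklore] bookkeeping around the cited formula; no
statement about representations is made in this file.

## References
* [DorflerIkenmeyerPanova2020] J. Dörfler, C. Ikenmeyer, G. Panova, *On geometric complexity
  theory: multiplicity obstructions are stronger than occurrence obstructions*, SIAM J. Appl.
  Algebra Geom. 4 (2020) = arXiv:1901.04576, §5.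
-/

namespace Literature.Computability.AlgebraicComplexity

namespace TableauEval

/-! ## §1 The pruned trie of symmetric-tensor entries -/

/-- Pruned trie of ring elements indexed by words: `empty` marks an all-zero subtree, `leaf a` a
value, `node [t₀, t₁, …]` the children by next letter. [folklore] -/
inductive PTrie (R : Type*) where
  /-- every word below evaluates to zero -/
  | empty : PTrie R
  /-- a value (at full depth) -/
  | leaf : R → PTrie R
  /-- children indexed by the next letter -/
  | node : List (PTrie R) → PTrie R

section Trie

variable {R : Type*} [CommRing R] [DecidableEq R]

/-- Is this the empty trie. [folklore] -/
def PTrie.isEmpty : PTrie R → Bool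
  | .empty => true
  | _ => false

/-- Leaf constructor, pruning zero. [folklore] -/
def PTrie.mkLeaf (a : R) : PTrie R := if a = 0 then .empty else .leaf a

/-- Node constructor, pruning an all-empty list of children. [folklore] -/
def PTrie.mkNode (ts : List (PTrie R)) : PTrie R :=
  if ts.all PTrie.isEmpty then .empty else .node ts

/-- Child `i` of a trie (`empty` if absent). [folklore] -/
def PTrie.child : PTrie R → ℕ → PTrie R
  | .node ts, i => ts.getD i .empty
  | _, _ => .empty

/-- Total lookup of a word (`0` on `empty`, on missing children and on depth mismatch).
[folklore] -/
def PTrie.find : List ℕ → PTrie R → R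
  | _, .empty => 0
  | [], .leaf a => a
  | _ :: _, .leaf _ => 0
  | [], .node _ => 0
  | i :: is, .node ts => PTrie.find is (ts.getD i .empty)

/-- The pruned trie of `symEntry P (pre ++ w)` over the words `w` of length `k` with letters
`< V`. [folklore] -/
def buildPTrie (P : Point R) (V : ℕ) : ℕ → List ℕ → PTrie R
  | 0, pre => PTrie.mkLeaf (symEntry P pre)
  | k + 1, pre => PTrie.mkNode ((List.range V).map fun i => buildPTrie P V k (pre ++ [i]))

end Trie

/-! ## §2 The programme -/

section Program

variable {R : Type*} [CommRing R] [DecidableEq R]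

/-- The plan of label `u`: which columns contain `u` (for a column-strict network processed in
increasing label order these are exactly the columns whose topmost unused box carries `u`).
[folklore] -/
def plan (cols : List Column) (u : ℕ) : List Bool := cols.map fun c => c.labels.elem u

/-- **Walk of one label over a state** (the lists of unused variables of the columns, in column
order): every active column gives its top box its `j`-th unused variable (parity of `j`
accumulated) while the walk descends the pruned trie along the chosen variables, abandoning a
prefix as soon as its subtree is empty; outcomes `(parity, entry of the word, new state)`.
[folklore] -/
def walkA : List Bool → List (List ℕ) → PTrie R → List (Bool × R × List (List ℕ))
  | [], _, t => match t with
    | .leaf a => [(false, a, [])]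
    | _ => []
  | _ :: _, [], _ => []
  | false :: ps, vs :: vss, t => (walkA ps vss t).map fun r => (r.1, r.2.1, vs :: r.2.2)
  | true :: ps, vs :: vss, t =>
      (List.range vs.length).flatMap fun j =>
        if (t.child (vs.getD j 0)).isEmpty then [] else
          (walkA ps vss (t.child (vs.getD j 0))).map fun r =>
            (xor (decide (j % 2 = 1)) r.1, r.2.1, vs.eraseIdx j :: r.2.2)

/-- Packed sort key of a state: bit `i·V + v` set iff variable `v` is unused in column `i`.
Used only to order states before compression; no property of it is ever needed. [folklore] -/
def keyOf (V : ℕ) (st : List (List ℕ)) : ℕ :=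
  ((st.zipIdx).map fun si => (si.1.map fun v => 2 ^ (si.2 * V + v)).sum).sum

/-- Merge step: insert `a` before the first element of the second list with a larger key, then
continue with `rest`. [folklore] -/
def mergeKAux {β : Type*} (a : ℕ × β) (rest : List (ℕ × β) → List (ℕ × β)) :
    List (ℕ × β) → List (ℕ × β)
  | [] => a :: rest []
  | b :: l₂ => if Nat.blt b.1 a.1 then b :: mergeKAux a rest l₂ else a :: rest (b :: l₂)

/-- Merge two lists by key. [folklore] -/
def mergeK {β : Type*} : List (ℕ × β) → List (ℕ × β) → List (ℕ × β)
  | [] => fun l₂ => l₂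
  | a :: l₁ => fun l₂ => mergeKAux a (mergeK l₁) l₂

/-- The elements at even / at odd positions. [folklore] -/
def splitF {α : Type*} (l : List α) : List α × List α :=
  l.foldr (fun a p => (a :: p.2, p.1)) ([], [])

/-- Merge sort by key with depth fuel; for every fuel the output is a permutation of the input
(proofs file), which is all that is used. [folklore] -/
def msortK {β : Type*} : ℕ → List (ℕ × β) → List (ℕ × β)
  | 0, l => l
  | d + 1, l => match l with
    | [] => []
    | [a] => [a]
    | a :: b :: l' => mergeK (msortK d (splitF (a :: b :: l')).1) (msortK d (splitF (a :: b :: l')).2)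

/-- Push a `(key, state, value)` triple onto a list, adding the values when the front STATE is
the same (keys are compared first only as a cheap filter). [folklore] -/
def pushA (a : ℕ × List (List ℕ) × R) :
    List (ℕ × List (List ℕ) × R) → List (ℕ × List (List ℕ) × R)
  | [] => [a]
  | b :: l => if a.1 == b.1 && a.2.1 = b.2.1 then (a.1, a.2.1, a.2.2 + b.2.2) :: l else a :: b :: l

/-- Add up the values of adjacent equal states. [folklore] -/
def compressA (l : List (ℕ × List (List ℕ) × R)) : List (ℕ × List (List ℕ) × R) :=
  l.foldr pushA []

/-- Signed product `± (v · e)`. [folklore] -/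
def smul3 (odd : Bool) (v e : R) : R := if odd then -(v * e) else v * e

/-- The expansion of a layer along label `u`: every `(key, state, value)` spawns its live
outcomes, keyed and weighted. [folklore] -/
def expandA (cols : List Column) (V : ℕ) (T : PTrie R) (u : ℕ) (L : List (ℕ × List (List ℕ) × R)) :
    List (ℕ × List (List ℕ) × R) :=
  L.flatMap fun e => (walkA (plan cols u) e.2.1 T).map fun r =>
    (keyOf V r.2.2, r.2.2, smul3 r.1 e.2.2 r.2.1)

/-- **One layer**: expand along label `u`, sort by key, add up equal states. [folklore] -/
def stepA (cols : List Column) (V : ℕ) (T : PTrie R) (u : ℕ) (L : List (ℕ × List (List ℕ) × R)) :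
    List (ℕ × List (List ℕ) × R) :=
  compressA (msortK (Nat.log2 (expandA cols V T u L).length + 2) (expandA cols V T u L))

/-- All layers along a list of labels. [folklore] -/
def layersA (cols : List Column) (V : ℕ) (T : PTrie R) :
    List ℕ → List (ℕ × List (List ℕ) × R) → List (ℕ × List (List ℕ) × R)
  | [], L => L
  | u :: us, L => layersA cols V T us (stepA cols V T u L)

/-- One more than the largest alternator variable of a network. [folklore] -/
def Network.varBound (N : Network) : ℕ :=
  ((N.cols.map fun c => c.vars.foldr max 0).foldr max 0) + 1

/-- The initial layer: every variable unused, value `1`. [folklore] -/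
def Network.initLayer (N : Network) : List (ℕ × List (List ℕ) × R) :=
  [(keyOf N.varBound (N.cols.map Column.vars), N.cols.map Column.vars, 1)]

/-- Sum of the values of a layer. [folklore] -/
def layerSum (L : List (ℕ × List (List ℕ) × R)) : R := (L.map fun x => x.2.2).sum

/-- **Label-major evaluation of the tableau network `N` at the point `P`** — equal to
`evalC P N` for column-strict networks passing the structural check (proofs file). [folklore] -/
def evalA (P : Point R) (N : Network) : R :=
  layerSum (layersA N.cols N.varBound (buildPTrie P N.varBound N.perLabel [])
    (List.range N.nlabels) N.initLayer)

end Program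

/-! ## §3 Sanity values (kernel) -/

/-- On the toy network `1 1 / 2 2` at `2 x₀ x₁` presented as two products,
`evalA = evalC = specL = -8`. [folklore] -/
example :
    let P : Point ℤ := ⟨[(1, [[1, 0], [0, 1]]), (1, [[0, 1], [1, 0]])]⟩
    let N : Network := ⟨2, 2, [⟨[0, 1], [0, 1]⟩, ⟨[0, 1], [0, 1]⟩]⟩
    evalA P N = -8 ∧ evalC P N = -8 ∧ specL (symEntry P) [0, 1] N.cols = -8 := by
  decide +kernel

/-- A `3 × 3` cross-check in the kernel: shape `(5,2,2)` (semistandard filling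
`0 0 0 1 2 / 1 1 / 2 2`), `d = m = 3`, at `per₃` of a `0/1` matrix with two doubled entries,
modulo `101`: `evalA = evalC`. [folklore] -/
example :
    let g : List (List (ZMod 101)) := [[1, 1, 0, 1, 0, 0, 0, 0, 0], [0, 0, 0, 0, 1, 0, 0, 0, 1],
      [1, 0, 0, 0, 0, 0, 0, 0, 0], [0, 0, 1, 0, 0, 0, 0, 0, 0], [0, 0, 0, 0, 0, 0, 0, 1, 0],
      [0, 0, 0, 0, 0, 0, 1, 0, 0], [0, 0, 0, 0, 0, 1, 0, 0, 0], [0, 0, 0, 0, 1, 0, 0, 0, 0],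
      [0, 0, 0, 0, 0, 0, 0, 0, 0]]
    let P : Point (ZMod 101) := ⟨(permsSign [0, 1, 2]).map fun q =>
      (1, (List.range 3).map fun i => g.map fun row => row.getD (i * 3 + q.2.getD i 0) 0)⟩
    let N : Network := ⟨3, 3, [⟨[0, 1, 2], [0, 1, 2]⟩, ⟨[0, 1, 2], [0, 1, 2]⟩, ⟨[0], [0]⟩,
      ⟨[0], [1]⟩, ⟨[0], [2]⟩]⟩
    evalA P N = evalC P N := by
  decide +kernel

end TableauEval

end Literature.Computability.AlgebraicComplexity
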